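import Summits.BirchSwinnertonDyer.Rank1Residual.GaloisImage.KolyvaginDerivativeLocalImageRat
import HarnessLib

/-!
# Certificate form of the prime-to-`p` degree hypothesis of THEOREM B at the bad places
# (`¬ p ∣ ord(w mod ∏ℓ)` from one small exponent per Kolyvagin prime) — file 6 of row T-DER-BN
# (cell `b2b-bsdres`, team n1011, seat p15 GEN 6; skeleton `cells/n1011/skel/T-DER-BN.md`)

HONEST FRAMING (cell `b2b-bsdres`, run/shared/lean/b2b/bsd-rank1-residual/, verbatim in every
file): the goal of the cell is to DELETE the COMBINATION-SHAPED residual classes of the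
Birch–Swinnerton-Dyer formula for ALL analytic-rank `≤ 1` elliptic curves over `ℚ` — "full BSD
formula for every rank `≤ 1` curve in class `C`" assembled STRICTLY from published theorems — so
that the rank-`≤ 1` remainder becomes exactly the CONSTRUCTION-SHAPED classes, which are TYPED
(missing-input `Prop`s), NOT attempted. This is not "finishing BSD". Team n1011 (N10 / N11, the
additive block X4 ∧ `p = 3`): research route on the CONSTRUCTION-SHAPED class X4; no claim beyond the
stated classes; nothing is booked. TOOL lemmas (no definition, no named fact, no `sorry`) for the
record writers who must discharge `hord` of `Rat.exists_map_red_eq_localization_of_not_dvd_orderOf`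
(file 4) / `Rat.exists_sigma_kappa_localImage_tate` (file 5) for concrete curves: the modulus
`∏_{ℓ ∈ r} ℓ` is astronomically large, but the hypothesis follows from ONE exponent `e_ℓ < ℓ` per
Kolyvagin prime with `w^{e_ℓ} ≡ 1 (mod ℓ)` and `p ∤ e_ℓ` (e.g. `e_ℓ = (ℓ − 1)/p^{v_p(ℓ−1)}` when `w`
is a `p^{v_p(ℓ−1)}`-th power residue mod `ℓ` — the 𝒫′ condition of skeleton STATUS v4), each a
`decide`/`norm_num`-sized check.

* `not_dvd_orderOf_of_pow_eq_one` — `x ^ e = 1`, `p ∤ e` ⇒ `p ∤ orderOf x`;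
* `Nat.modEq_one_finsetProd_of_forall` — `w^E ≡ 1` modulo a product of pairwise coprime moduli from
  the congruence modulo each;
* `Rat.not_dvd_orderOf_cast_prod_of_forall_pow` — the certificate: exponents `e_ℓ` with
  `(w : ZMod ℓ) ^ e_ℓ = 1` and `p ∤ e_ℓ` for every `ℓ ∈ r` give `¬ p ∣ orderOf (w : ZMod (∏ ℓ))`.
-/

namespace Summit.BirchSwinnertonDyer.Rank1Residual.GaloisImage

namespace Derivative

open Finset

/-- `x ^ e = 1` with `p ∤ e` forces `p ∤ orderOf x` (`orderOf x ∣ e`). [folklore] -/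
theorem not_dvd_orderOf_of_pow_eq_one {G : Type*} [Monoid G] {p e : ℕ} {x : G} (he : x ^ e = 1)
    (hpe : ¬ p ∣ e) : ¬ p ∣ orderOf x :=
  fun h => hpe (h.trans (orderOf_dvd_of_pow_eq_one he))

/-- A congruence `a ≡ 1` modulo every member of a family of pairwise coprime moduli holds modulo
their product. [folklore] -/
theorem Nat.modEq_one_finsetProd_of_forall {ι : Type*} (s : Finset ι) (n : ι → ℕ) (a : ℕ)
    (hcop : ∀ i ∈ s, ∀ j ∈ s, i ≠ j → (n i).Coprime (n j)) (h : ∀ i ∈ s, a ≡ 1 [MOD n i]) :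
    a ≡ 1 [MOD ∏ i ∈ s, n i] := by
  classical
  induction s using Finset.induction_on with
  | empty => simp [Nat.ModEq, Nat.mod_one]
  | insert b s hb ih =>
    rw [Finset.prod_insert hb]
    have hb' : (n b).Coprime (∏ i ∈ s, n i) :=
      Nat.Coprime.prod_right fun i hi =>
        hcop b (Finset.mem_insert_self b s) i (Finset.mem_insert_of_mem hi)
          (fun hbi => hb (hbi ▸ hi))
    exact (Nat.modEq_and_modEq_iff_modEq_mul hb').mp
      ⟨h b (Finset.mem_insert_self b s),
        ih (fun i hi j hj hij => hcop i (Finset.mem_insert_of_mem hi) j (Finset.mem_insert_of_mem hj) hij)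
          (fun i hi => h i (Finset.mem_insert_of_mem hi))⟩

/-- **Certificate for `¬ p ∣ ord(w mod ∏_{ℓ∈s} n_ℓ)`**: pairwise coprime moduli `n_ℓ` (the
Kolyvagin primes), and for each one an exponent `e_ℓ` with `w^{e_ℓ} ≡ 1 (mod n_ℓ)` and `p ∤ e_ℓ`;
then `w^{∏ e_ℓ} ≡ 1 (mod ∏ n_ℓ)` and `p ∤ ∏ e_ℓ` (`p` prime), so `p ∤ orderOf (w : ZMod (∏ n_ℓ))` —
the hypothesis `hord` of `Rat.exists_map_red_eq_localization_of_not_dvd_orderOf`. [folklore] -/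
theorem not_dvd_orderOf_cast_prod_of_forall_pow {ι : Type*} (s : Finset ι) (n e : ι → ℕ) (w p : ℕ)
    (hp : p.Prime) (hcop : ∀ i ∈ s, ∀ j ∈ s, i ≠ j → (n i).Coprime (n j))
    (hpow : ∀ i ∈ s, ((w : ZMod (n i)) ^ e i) = 1) (hpe : ∀ i ∈ s, ¬ p ∣ e i) :
    ¬ p ∣ orderOf ((w : ZMod (∏ i ∈ s, n i))) := by
  classical
  refine not_dvd_orderOf_of_pow_eq_one (e := ∏ i ∈ s, e i) ?_ ?_
  · -- `w ^ ∏ e ≡ 1 (mod ∏ n)`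
    have hmod : ∀ i ∈ s, w ^ (∏ j ∈ s, e j) ≡ 1 [MOD n i] := by
      intro i hi
      have h1 : w ^ e i ≡ 1 [MOD n i] := by
        have h := hpow i hi
        rw [← Nat.cast_pow, ← Nat.cast_one, ZMod.natCast_eq_natCast_iff] at h
        exact h
      obtain ⟨k, hk⟩ := Finset.dvd_prod_of_mem e hi
      rw [hk, pow_mul]
      simpa using h1.pow k
    have h := Nat.modEq_one_finsetProd_of_forall s n _ hcop hmod
    rw [← ZMod.natCast_eq_natCast_iff, Nat.cast_pow, Nat.cast_one] at h
    exact h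
  · exact fun h => by
      obtain ⟨i, hi, hdvd⟩ := (hp.prime.dvd_finsetProd_iff _).mp h
      exact hpe i hi hdvd

end Derivative

end Summit.BirchSwinnertonDyer.Rank1Residual.GaloisImage
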